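import Summits.Ventures.CertifiedManyBodySolver.Certificates.HubbardSquare_U6_n4o5_tp3o10_lower_row655
import HarnessLib
import HarnessLib.Audit

/-!
# Ventures/CertifiedManyBodySolver — Certificates/HubbardSquare_n4o5_chordPlaneStation_posd_discharge_r655.lean

HONEST FRAMING: bookkeeping only. The C-135 words of this seat (`Certificates/HubbardSquare_n4o5_stiffness_chordPlaneStation_posd_{boxes_A,boxes_B,boxes_C,points_A,points_B}.lean`,
hubbard-fast-reuse-2 g14, object (N1) «n = 4/5 COLUMN d under the chord of the two split planes' t′ ≥ 0 faces») take the (6, ⅘, +3/10) floor BY VALUE as the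
hypothesis `h29v : −3485358549925255656531141/3022314549036572936765440 ≤ e(1, 3/10, 6, 4/5)` (hubbard-algo-eng-8 twinchain -29, sr-mbsolver-ref-3 g217 R3.404-29s SIGNED
2026-08-29T12:26:50Z) because the registry row and lit-4's claim node did not exist when the object was planned. Both have since landed: CERTIFIED #655 (6, ⅘, +3/10) and
`Certificates/HubbardSquare_U6_n4o5_tp3o10_lower_row655.lean` (sr-mbsolver-lit-4 g34): `cert_r655_bs_GU6n4o5tp3o10_…_uprime : Prop` IS that very inequality, so `h29v` is
DISCHARGED BY NAME — the theorem below is the identity map, recorded so the link is citable (tag «R29 by value» → «#655 BY NAME»). No number moves; no new word; not a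
superconductivity or `T_c` verdict; NO summit statement is proved by this seat. Zero compute, no definition, no claim node, no `sorry`.
Cell `pub/hubbard-fast` (D-0154 (1)(A) CERTIFICATE REUSE), seat `hubbard-fast-reuse-2` g14 (the #648 → C-134 precedent `HubbardSquare_n7o8_splitPlaneStation_d2_discharge_r648.lean`, g13).
-/

noncomputable section

namespace Summit.Ventures.CertifiedManyBodySolver.Certificates

open Literature.MathematicalPhysics.QuantumLattice
open Literature.MathematicalPhysics.QuantumLattice.ThermodynamicLimit

/-- **`h29v` of C-135 ≡ the claim node of CERTIFIED #655.** The by-value hypothesis of the (N1) words is the node's own sentence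
(`−3485358549925255656531141/3022314549036572936765440 ≤ e₀(1, 3/10, 6, 4/5)`, print −1.1532084082): feed `h655` wherever `h29v` is asked. [folklore] -/
theorem n4o5_posd_h29v_of_node (h655 : cert_r655_bs_GU6n4o5tp3o10_w3_b4_R2_ob5p2_kry1_kry2c3rel_hanK7B4D4_KN4_PR20d4_hanK8c2s_uprime) :
    (((-3485358549925255656531141/3022314549036572936765440 : ℚ)) : ℝ) ≤ energyDensityTT' 1 (3/10) (6) (4 / 5) := h655

/-- The endpoint of `h29v` is the referee's factored print `−3485358549925255656531141/(5·2⁷⁹)` and its 10-dp outward-down print is `−1.1532084082` (decidable). [folklore] -/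
theorem n4o5_posd_h29v_literals :
    ((-3485358549925255656531141/3022314549036572936765440 : ℚ) = -3485358549925255656531141/(5*2^79)) ∧
    ((-11532084082 : ℚ) / 10 ^ 10 ≤ -3485358549925255656531141/3022314549036572936765440) ∧
    ((-3485358549925255656531141/3022314549036572936765440 : ℚ) - (-11532084082 : ℚ) / 10 ^ 10 < 1 / 10 ^ 10) := by
  norm_num

end Summit.Ventures.CertifiedManyBodySolver.Certificates

end
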